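import Mathlib
import HarnessLib
import Summits.HubbardSuperconductivity.HubbardSuperconductivity.Theses.WeakCouplingBCS
import Literature.MathematicalPhysics.QuantumLattice.DWaveOrderParameterProofs
import Literature.MathematicalPhysics.QuantumLattice.HubbardGrandCanonicalDensity
import Literature.MathematicalPhysics.QuantumLattice.DWaveSourceFreePressure
import Literature.MathematicalPhysics.QuantumLattice.HubbardFreeTorusGroundEnergy
import Summits.HubbardSuperconductivity.HubbardSuperconductivity.Theorems.WeakCouplingBCSWcbcsBcsConstructionHamiltonianNormBound
import Summits.HubbardSuperconductivity.HubbardSuperconductivity.Theorems.WeakCouplingBCSWcbcsBcsConstructionDoubleCommutatorBound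
import Summits.HubbardSuperconductivity.HubbardSuperconductivity.Theorems.WeakCouplingBCSWcbcsBcsConstructionTrialStateBound
import Summits.HubbardSuperconductivity.HubbardSuperconductivity.Theorems.WeakCouplingBCSWcbcsBcsConstructionEnergyDensityLimit
import Summits.HubbardSuperconductivity.HubbardSuperconductivity.Theorems.WeakCouplingBCSWcbcsBcsConstructionLroSeedOfOrderFloor

/-!
# Crux `WcbcsBcsConstruction` — line `lro-seed-kink-bridge` (lead skeleton, rev L4, gen-1 lead)

Crux item stmt-HubbardSuperconductivity-2010, route `HubbardSuperconductivity/WeakCouplingBCS`: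
`∃ δ ∈ (0,1/2) ∃ U₀ > 0 ∃ C > 0 ∀ U ∈ (0,U₀) ∃ μ`, (D) the grand-canonical tracial ground-state density of
`hubbardTorusWith 2 (L+1) 1 U μ` tends to `1 - δ` AND (O) `exp(-C/U²) ≤ dWaveOrderParameter U μ`.

LINE (Koma–Tasaki 1994, Thm 2.2, read upward): (O) is a statement about sourced ground-state ENERGIES
(`le_dWaveOrderParameter_of_le_liminf_energyGain`); a linear energy gain at every fixed source `h > 0` is produced at
finite `L` by the Koma–Tasaki trial state built on a number-definite near-ground state carrying `d`-wave pair LRO (a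
"seed"). Gen 0 (rev L1–L3) LANDED every provable stub of the line (finite-`L` plumbing p72109 p72669 p73068 p72757;
thermodynamic limit of the GC ground-state energy density p73950 p74002 p75203 p74734 p74348 p76736; Griffiths
p72803; the converse certificate "order floor ⇒ seeds" p76320 p74267 p75860).

Rev L4 (this file) RESHAPES the open end to its weakest composable form and proves the dictionary in both directions:
* `orderFloor_of_seeds` (PROVED here, to be landed): POINTWISE in `(U, μ)`, seeds of strength `ε` force
  `ε ≤ dWaveOrderParameter U μ` (rev L3 had this only inside the composition, for `ε = e^{-C/U²}`).
* `stub_bcsSeedCore` (the ONE composing stub, OPEN = the constructive Kohn–Luttinger/BCS content): `∃ δ ∃ U₀ ∃ C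
  ∀ U ∃ μ`, density-matched AND seeds of strength `e^{-C/U²}` at that `μ`. The rev-L3 pair {`stub_lroSeed`
  (seeds uniformly over a doping window and over ALL density-matched `μ`), `stub_regularEquationOfState` (`h = 0`
  regular equation of state on a window)} implied it and was strictly stronger; neither uniformity is needed.
* `bcsSeedCore_of_bcsConstruction` (PROVED here): the crux implies `stub_bcsSeedCore` back (`C ↦ C + 1`,
  `U₀ ↦ min U₀ 1`, via p76320). Hence core ⟺ crux is kernel-checked: this line is a DICTIONARY between finite-`L`
  near-ground LRO seeds and the Koma–Tasaki order parameter, complete modulo the crux itself.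
* Side stubs (provable now; calibration and bridge theorems for ANY line on this crux, registered for workers):
  `stub_interactionComparison` (the sourced pair density at coupling `U'` versus `U ≤ U'`: the top stairs are
  free-gas stairs), `stub_freeSourcedGroundEnergy` (BdG ground energy of the sourced free torus),
  `stub_dWaveCooperSumLowerBound` (the `d`-wave-weighted zero-temperature Cooper logarithm on the torus),
  `stub_secantSlopes_of_concave_close` + `stub_gcDensity_limitPoints_near_free` (density jumps of the interacting
  equation of state are `O(√U)` around the free density), `stub_eosTransfer` (sourced energy density `C¹` in `μ`
  uniformly in `h` ⇒ the `h = 0` equation of state is `C¹`: how a sourced construction discharges (D) through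
  `exists_tendsto_gcDensity_of_regularWindow`).
-/

namespace Summit.HubbardSuperconductivity.HubbardSuperconductivity.Cruxes.WcbcsBcsConstruction.LroSeedKinkBridge

open Literature.MathematicalPhysics.QuantumLattice Literature.Probability.LatticeModels Matrix Filter
open scoped Matrix.Norms.L2Operator ComplexOrder Topology

/-! ### Finite-`L` Koma–Tasaki plumbing (rev L1 stubs S1a–S1c, landed by gen 0) -/

/-- Rev-L1 stub S1a, LANDED (p72109). [folklore] -/
theorem hamiltonianNormBound :
    ∃ B₁ : ℝ, 0 < B₁ ∧ ∀ (L : ℕ) [NeZero L] (U μ : ℝ), 0 ≤ U →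
      ‖hubbardTorusWith 2 L 1 U μ‖ ≤ B₁ * (1 + U + |μ|) * (L : ℝ) ^ 2 :=
  Summit.HubbardSuperconductivity.HubbardSuperconductivity.Theorems.stub_hamiltonianNormBound

/-- Rev-L1 stub S1b, LANDED (p72669). [cite: KomaTasaki1994, Theorem 2.2] -/
theorem doubleCommutatorBound :
    ∃ B₂ : ℝ, 0 < B₂ ∧ ∀ (L : ℕ) [NeZero L] (U μ : ℝ), 0 ≤ U →
      ‖(pairField dWaveFormFactor L + (pairField dWaveFormFactor L)ᴴ) *
            ((pairField dWaveFormFactor L + (pairField dWaveFormFactor L)ᴴ) * hubbardTorusWith 2 L 1 U μ -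
              hubbardTorusWith 2 L 1 U μ * (pairField dWaveFormFactor L + (pairField dWaveFormFactor L)ᴴ)) -
          ((pairField dWaveFormFactor L + (pairField dWaveFormFactor L)ᴴ) * hubbardTorusWith 2 L 1 U μ -
              hubbardTorusWith 2 L 1 U μ * (pairField dWaveFormFactor L + (pairField dWaveFormFactor L)ᴴ)) *
            (pairField dWaveFormFactor L + (pairField dWaveFormFactor L)ᴴ)‖ ≤
        B₂ * (1 + U + |μ|) * (L : ℝ) ^ 2 :=
  Summit.HubbardSuperconductivity.HubbardSuperconductivity.Theorems.stub_doubleCommutatorBound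

/-- The planner's `stub_seedTrialEnergy`, a theorem since wave 1 of gen 0 (S1c = p73068 applied to S1a, S1b):
the Koma–Tasaki trial state on a unit `n`-particle vector `Ψ` with `⟨Ψ, O²Ψ⟩ ≥ s²`, `O = Δ_d + Δ_d†`.
[cite: KomaTasaki1994, Theorem 2.2] -/
theorem seedTrialEnergy :
    ∃ B : ℝ, 0 < B ∧ ∀ (L : ℕ) [NeZero L] (U μ h s : ℝ), 0 ≤ U → 0 ≤ h → 0 < s →
      ∀ (Ψ : Fock (Orb (FermionTorus 2 L))) (n : ℕ), star Ψ ⬝ᵥ Ψ = 1 → IsNParticle n Ψ →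
        s ^ 2 ≤ (expect ((pairField dWaveFormFactor L + (pairField dWaveFormFactor L)ᴴ) *
          (pairField dWaveFormFactor L + (pairField dWaveFormFactor L)ᴴ)) Ψ).re →
        (dWaveSourceTorus L U μ h).groundEnergy ≤
          (hubbardTorusWith 2 L 1 U μ).groundEnergy +
            ((expect (hubbardTorusWith 2 L 1 U μ) Ψ).re - (hubbardTorusWith 2 L 1 U μ).groundEnergy) / 2 +
            B * (1 + U + |μ|) * (L : ℝ) ^ 3 *
              Real.sqrt ((expect (hubbardTorusWith 2 L 1 U μ) Ψ).re - (hubbardTorusWith 2 L 1 U μ).groundEnergy) / s +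
            B * (1 + U + |μ|) * (L : ℝ) ^ 2 / s ^ 2 - h * s :=
  Summit.HubbardSuperconductivity.HubbardSuperconductivity.Theorems.stub_trialStateBound
    hamiltonianNormBound doubleCommutatorBound

/-- **Thermodynamic limit of the grand-canonical ground-state energy density of the Hubbard torus**, LANDED
(p76736, with p73950 p74002 p75203 p74734 p74348 behind it). [folklore] -/
theorem torusEnergyDensityLimit (U μ : ℝ) :
    ∃ e : ℝ, Tendsto (fun L : ℕ => (hubbardTorusWith 2 (L + 1) 1 U μ).groundEnergy / ((L + 1 : ℕ) : ℝ) ^ 2)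
      atTop (𝓝 e) :=
  Summit.HubbardSuperconductivity.HubbardSuperconductivity.Theorems.stub_torusGcEnergyDensityLimit U μ

/-- **Converse certificate (LANDED p76320).** An order floor `ε` at `(U, μ)` produces seeds of strength `ε/2` there.
[cite: KomaTasaki1994, Theorem 2.2] -/
theorem lroSeedOfOrderFloor : ∀ (U μ ε : ℝ), 0 < ε → ε ≤ dWaveOrderParameter U μ →
    ∃ (n : ℕ → ℕ) (Ψ : ∀ L : ℕ, Fock (Orb (FermionTorus 2 (L + 1)))),
      (∀ L, star (Ψ L) ⬝ᵥ Ψ L = 1 ∧ IsNParticle (n L) (Ψ L)) ∧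
      Tendsto (fun L : ℕ => ((expect (hubbardTorusWith 2 (L + 1) 1 U μ) (Ψ L)).re -
        (hubbardTorusWith 2 (L + 1) 1 U μ).groundEnergy) / ((L + 1 : ℕ) : ℝ) ^ 2) atTop (𝓝 0) ∧
      ∃ L₀ : ℕ, ∀ L : ℕ, L₀ ≤ L → 4 * (ε / 2) ^ 2 * ((L + 1 : ℕ) : ℝ) ^ 4 ≤
        (expect ((pairField dWaveFormFactor (L + 1) + (pairField dWaveFormFactor (L + 1))ᴴ) *
          (pairField dWaveFormFactor (L + 1) + (pairField dWaveFormFactor (L + 1))ᴴ)) (Ψ L)).re :=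
  Summit.HubbardSuperconductivity.HubbardSuperconductivity.Theorems.stub_lroSeedOfOrderFloor

/-! ### Kink algebra (pure real arithmetic, from rev L3) -/

/-- With `s = 2εL²`, `e = xL²` the trial bound `E_h ≤ E₀ + e/2 + BK L³√e/s + BK L²/s² - hs` reads
`ε - x/(4h) - BK√x/(4hε) - BK/(8hε²L⁴) ≤ (E₀ - E_h)/(2hL²)`. [folklore] -/
theorem kink_algebra {ε h Lr B K x E₀ Eh : ℝ} (hε : 0 < ε) (hh : 0 < h) (hL : 0 < Lr)
    (htrial : Eh ≤ E₀ + (x * Lr ^ 2) / 2 + B * K * Lr ^ 3 * Real.sqrt (x * Lr ^ 2) / (2 * ε * Lr ^ 2) +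
      B * K * Lr ^ 2 / (2 * ε * Lr ^ 2) ^ 2 - h * (2 * ε * Lr ^ 2)) :
    ε - x / (4 * h) - B * K / (4 * h * ε) * Real.sqrt x - B * K / (8 * h * ε ^ 2 * Lr ^ 4) ≤
      (E₀ - Eh) / (2 * h * Lr ^ 2) := by
  have hsq : Real.sqrt (x * Lr ^ 2) = Real.sqrt x * Lr := by
    rw [Real.sqrt_mul' x (by positivity), Real.sqrt_sq hL.le]
  rw [hsq] at htrial
  have hpos : 0 < 2 * h * Lr ^ 2 := by positivity
  rw [le_div_iff₀ hpos]
  have h1 : B * K * Lr ^ 3 * (Real.sqrt x * Lr) / (2 * ε * Lr ^ 2) =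
      B * K / (4 * h * ε) * Real.sqrt x * (2 * h * Lr ^ 2) := by
    field_simp
    ring
  have h2 : B * K * Lr ^ 2 / (2 * ε * Lr ^ 2) ^ 2 = B * K / (8 * h * ε ^ 2 * Lr ^ 4) * (2 * h * Lr ^ 2) := by
    field_simp
    ring
  have h3 : x * Lr ^ 2 / 2 = x / (4 * h) * (2 * h * Lr ^ 2) := by
    field_simp
    ring
  have h4 : h * (2 * ε * Lr ^ 2) = ε * (2 * h * Lr ^ 2) := by ring
  rw [h1, h2, h3, h4] at htrial
  nlinarith [htrial]

/-- The remainder of the kink bound tends to `0`: with `x_L → 0`,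
`x_L/(4h) + c₁√x_L + c₂ (L+1)⁻⁴ → 0`, so the lower bound tends to `ε`. [folklore] -/
theorem remainder_tendsto {x : ℕ → ℝ} (hx : Tendsto x atTop (𝓝 0)) (ε h c₁ c₂ : ℝ) :
    Tendsto (fun L : ℕ => ε - x L / (4 * h) - c₁ * Real.sqrt (x L) - c₂ / (((L + 1 : ℕ) : ℝ)) ^ 4)
      atTop (𝓝 ε) := by
  have h1 : Tendsto (fun L : ℕ => x L / (4 * h)) atTop (𝓝 0) := by
    simpa using hx.div_const (4 * h)
  have h2 : Tendsto (fun L : ℕ => c₁ * Real.sqrt (x L)) atTop (𝓝 0) := by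
    have := (Real.continuous_sqrt.tendsto 0).comp hx
    simpa using this.const_mul c₁
  have h3 : Tendsto (fun L : ℕ => c₂ / (((L + 1 : ℕ) : ℝ)) ^ 4) atTop (𝓝 0) := by
    have hL : Tendsto (fun L : ℕ => (((L + 1 : ℕ) : ℝ)) ^ 4) atTop atTop := by
      refine (tendsto_pow_atTop (by norm_num : (4 : ℕ) ≠ 0)).comp ?_
      exact tendsto_natCast_atTop_atTop.comp (tendsto_add_atTop_nat 1)
    exact (tendsto_const_nhds (x := c₂)).div_atTop hL
  have := ((tendsto_const_nhds (x := ε)).sub h1).sub h2 |>.sub h3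
  simpa using this

/-! ### The forward dictionary, pointwise in `(U, μ)`: seeds ⇒ order floor (PROVED; rev L4) -/

/-- **Seeds force an order floor, pointwise.** At fixed `(U, μ)` with `U ≥ 0`: if there are unit, number-definite
states `Ψ_L` on the `(L+1)`-tori whose energy excess over the grand-canonical ground energy is `o((L+1)²)` and whose
`d`-wave pair LRO is `⟨Ψ_L, O²Ψ_L⟩ ≥ 4ε²(L+1)⁴` eventually (`O = Δ_d + Δ_d†`), then `ε ≤ dWaveOrderParameter U μ`.
Proof: the Koma–Tasaki trial state (`seedTrialEnergy`, `s_L = 2ε(L+1)²`) gives, at every fixed `h ∈ (0,1)`, the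
linear energy gain `(E(0) - E(h))/(2h(L+1)²) ≥ ε - o(1)` (`kink_algebra`, `remainder_tendsto`), and
`le_dWaveOrderParameter_of_le_liminf_energyGain` converts the gain into the floor. [cite: KomaTasaki1994, Theorem 2.2] -/
theorem orderFloor_of_seeds (U μ ε : ℝ) (hU : 0 ≤ U) (hε : 0 < ε)
    (hseed : ∃ (n : ℕ → ℕ) (Ψ : ∀ L : ℕ, Fock (Orb (FermionTorus 2 (L + 1)))),
      (∀ L, star (Ψ L) ⬝ᵥ Ψ L = 1 ∧ IsNParticle (n L) (Ψ L)) ∧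
      Tendsto (fun L : ℕ => ((expect (hubbardTorusWith 2 (L + 1) 1 U μ) (Ψ L)).re -
        (hubbardTorusWith 2 (L + 1) 1 U μ).groundEnergy) / ((L + 1 : ℕ) : ℝ) ^ 2) atTop (𝓝 0) ∧
      ∃ L₀ : ℕ, ∀ L : ℕ, L₀ ≤ L → 4 * ε ^ 2 * ((L + 1 : ℕ) : ℝ) ^ 4 ≤
        (expect ((pairField dWaveFormFactor (L + 1) + (pairField dWaveFormFactor (L + 1))ᴴ) *
          (pairField dWaveFormFactor (L + 1) + (pairField dWaveFormFactor (L + 1))ᴴ)) (Ψ L)).re) :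
    ε ≤ dWaveOrderParameter U μ := by
  obtain ⟨n, Ψ, hΨ, hexc, L₀, hlro⟩ := hseed
  obtain ⟨B, hB, htrial⟩ := seedTrialEnergy
  set K : ℝ := 1 + U + |μ| with hK_def
  -- the excess energy density `x_L → 0`
  set x : ℕ → ℝ := fun L => ((expect (hubbardTorusWith 2 (L + 1) 1 U μ) (Ψ L)).re -
      (hubbardTorusWith 2 (L + 1) 1 U μ).groundEnergy) / ((L + 1 : ℕ) : ℝ) ^ 2 with hx_def
  have hx : Tendsto x atTop (𝓝 0) := hexc
  refine le_dWaveOrderParameter_of_le_liminf_energyGain U μ zero_lt_one fun h hh => ?_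
  -- lower bound `g_L ≤ f_L` for `L ≥ L₀`
  have hlow : ∀ᶠ L : ℕ in atTop,
      ε - x L / (4 * h) - B * K / (4 * h * ε) * Real.sqrt (x L) - B * K / (8 * h * ε ^ 2) / (((L + 1 : ℕ) : ℝ)) ^ 4 ≤
        ((dWaveSourceTorus (L + 1) U μ 0).groundEnergy - (dWaveSourceTorus (L + 1) U μ h).groundEnergy) /
          (2 * h * (((L + 1 : ℕ) : ℝ)) ^ 2) := by
    refine eventually_atTop.2 ⟨L₀, fun L hL => ?_⟩
    have hLr : (0 : ℝ) < ((L + 1 : ℕ) : ℝ) := by positivity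
    have hs : (0 : ℝ) < 2 * ε * (((L + 1 : ℕ) : ℝ)) ^ 2 := by positivity
    have hseedL := hlro L hL
    have hsq : (2 * ε * (((L + 1 : ℕ) : ℝ)) ^ 2) ^ 2 ≤
        (expect ((pairField dWaveFormFactor (L + 1) + (pairField dWaveFormFactor (L + 1))ᴴ) *
          (pairField dWaveFormFactor (L + 1) + (pairField dWaveFormFactor (L + 1))ᴴ)) (Ψ L)).re := by
      have : (2 * ε * (((L + 1 : ℕ) : ℝ)) ^ 2) ^ 2 = 4 * ε ^ 2 * (((L + 1 : ℕ) : ℝ)) ^ 4 := by ring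
      rw [this]
      exact hseedL
    have key := htrial (L + 1) U μ h (2 * ε * (((L + 1 : ℕ) : ℝ)) ^ 2) hU hh.1.le hs (Ψ L) (n L)
      (hΨ L).1 (hΨ L).2 hsq
    have hxe : (expect (hubbardTorusWith 2 (L + 1) 1 U μ) (Ψ L)).re -
        (hubbardTorusWith 2 (L + 1) 1 U μ).groundEnergy = x L * (((L + 1 : ℕ) : ℝ)) ^ 2 := by
      simp only [hx_def]
      field_simp
    rw [hxe] at key
    rw [dWaveSourceTorus_zero]
    have := kink_algebra (B := B) (K := K) hε hh.1 hLr key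
    have hrw : B * K / (8 * h * ε ^ 2 * (((L + 1 : ℕ) : ℝ)) ^ 4) =
        B * K / (8 * h * ε ^ 2) / (((L + 1 : ℕ) : ℝ)) ^ 4 := by
      rw [div_div]
    rw [hrw] at this
    exact this
  -- the lower bound tends to `ε`
  have hlim := remainder_tendsto hx ε h (B * K / (4 * h * ε)) (B * K / (8 * h * ε ^ 2))
  rw [← hlim.liminf_eq]
  refine liminf_le_liminf hlow hlim.isBoundedUnder_ge ?_
  exact isCoboundedUnder_ge_of_eventually_le atTop
    (x := 2 * ∑ e ∈ insert (0 : Site 2) unitSteps, |dWaveFormFactor e / Real.sqrt 2|)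
    (Eventually.of_forall fun L =>
      (energyGain_div_le_dWaveSourceDensity U μ hh.1).trans (dWaveSourceDensity_le_const _ U μ h))

/-! ### The ONE composing stub (OPEN): the constructive BCS core, in its weakest composable form -/

/-- Stub (OPEN — crux-strength, held by the lead; rev L4 core). **Density-matched near-ground `d`-wave LRO seeds at
Kohn–Luttinger strength, pointwise.** There are a doping `δ ∈ (0,1/2)`, a weak-coupling window `(0,U₀)` and `C > 0`
such that for every `U ∈ (0,U₀)` SOME chemical potential `μ` is (D) density-matched — the grand-canonical tracial
ground-state density of `hubbardTorusWith 2 (L+1) 1 U μ` tends to `1 - δ` — and carries seeds: unit `n_L`-particle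
states `Ψ_L` with excitation energy `o((L+1)²)` above the grand-canonical ground energy and
`⟨Ψ_L, (Δ_d + Δ_d†)² Ψ_L⟩ ≥ 4e^{-2C/U²}(L+1)⁴` for large `L`. Equivalent to the crux (`WcbcsBcsConstruction_of` /
`bcsSeedCore_of_bcsConstruction` below); its content is the constructive Kohn–Luttinger/BCS programme on the bottom
stair `h ↓ 0` (barriers `WeakCouplingCeiling`, `PerturbativeInvisibilityOfPairing` apply verbatim). Weaker than the
rev-L3 pair (`stub_lroSeed` uniform over `δ ∈ [a,b]` and all density-matched `μ`; `stub_regularEquationOfState`).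
[cite: KomaTasaki1994, Theorem 2.2] -/
theorem stub_bcsSeedCore :
    ∃ δ ∈ Set.Ioo (0:ℝ) (1 / 2), ∃ U₀ : ℝ, 0 < U₀ ∧ ∃ C : ℝ, 0 < C ∧ ∀ U ∈ Set.Ioo (0:ℝ) U₀, ∃ μ : ℝ,
      Filter.Tendsto (fun L : ℕ => ((hubbardTorusWith 2 (L + 1) 1 U μ).groundStateFunctional
        totalNumber).re / ((L + 1 : ℕ) : ℝ) ^ 2) Filter.atTop (nhds (1 - δ)) ∧
      ∃ (n : ℕ → ℕ) (Ψ : ∀ L : ℕ, Fock (Orb (FermionTorus 2 (L + 1)))),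
        (∀ L, star (Ψ L) ⬝ᵥ Ψ L = 1 ∧ IsNParticle (n L) (Ψ L)) ∧
        Tendsto (fun L : ℕ => ((expect (hubbardTorusWith 2 (L + 1) 1 U μ) (Ψ L)).re -
          (hubbardTorusWith 2 (L + 1) 1 U μ).groundEnergy) / ((L + 1 : ℕ) : ℝ) ^ 2) atTop (𝓝 0) ∧
        ∃ L₀ : ℕ, ∀ L : ℕ, L₀ ≤ L → 4 * Real.exp (-C / U ^ 2) ^ 2 * ((L + 1 : ℕ) : ℝ) ^ 4 ≤
          (expect ((pairField dWaveFormFactor (L + 1) + (pairField dWaveFormFactor (L + 1))ᴴ) *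
            (pairField dWaveFormFactor (L + 1) + (pairField dWaveFormFactor (L + 1))ᴴ)) (Ψ L)).re := by
  sorry

/-! ### Composition: the core stub implies the crux BY NAME, and conversely -/

/-- **The line closes the crux modulo its core stub.** `δ, U₀, C, μ` from `stub_bcsSeedCore`; (D) is carried over
and (O) is `orderFloor_of_seeds` at `ε = e^{-C/U²}`. [cite: KomaTasaki1994, §1] -/
theorem WcbcsBcsConstruction_of :
    Summit.HubbardSuperconductivity.HubbardSuperconductivity.Theses.WeakCouplingBCS.WcbcsBcsConstruction := by
  obtain ⟨δ, hδ, U₀, hU₀, C, hC, hcore⟩ := stub_bcsSeedCore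
  refine ⟨δ, hδ, U₀, hU₀, C, hC, fun U hU => ?_⟩
  obtain ⟨μ, hdens, hseed⟩ := hcore U hU
  exact ⟨μ, hdens, orderFloor_of_seeds U μ (Real.exp (-C / U ^ 2)) hU.1.le (Real.exp_pos _) hseed⟩

/-- **Conversely, the crux implies the core stub** (`U₀ ↦ min U₀ 1`, `C ↦ C + 1`): at the crux's density-matched
`μ`, the order floor `e^{-C/U²}` yields seeds of strength `e^{-C/U²}/2 ≥ e^{-(C+1)/U²}` (`U ≤ 1`) by the landed
converse certificate `lroSeedOfOrderFloor` (p76320). So `stub_bcsSeedCore ⟺ WcbcsBcsConstruction`: the line is a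
dictionary, complete modulo the crux. [cite: KomaTasaki1994, Theorem 2.2] -/
theorem bcsSeedCore_of_bcsConstruction
    (hcrux : Summit.HubbardSuperconductivity.HubbardSuperconductivity.Theses.WeakCouplingBCS.WcbcsBcsConstruction) :
    ∃ δ ∈ Set.Ioo (0:ℝ) (1 / 2), ∃ U₀ : ℝ, 0 < U₀ ∧ ∃ C : ℝ, 0 < C ∧ ∀ U ∈ Set.Ioo (0:ℝ) U₀, ∃ μ : ℝ,
      Filter.Tendsto (fun L : ℕ => ((hubbardTorusWith 2 (L + 1) 1 U μ).groundStateFunctional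
        totalNumber).re / ((L + 1 : ℕ) : ℝ) ^ 2) Filter.atTop (nhds (1 - δ)) ∧
      ∃ (n : ℕ → ℕ) (Ψ : ∀ L : ℕ, Fock (Orb (FermionTorus 2 (L + 1)))),
        (∀ L, star (Ψ L) ⬝ᵥ Ψ L = 1 ∧ IsNParticle (n L) (Ψ L)) ∧
        Tendsto (fun L : ℕ => ((expect (hubbardTorusWith 2 (L + 1) 1 U μ) (Ψ L)).re -
          (hubbardTorusWith 2 (L + 1) 1 U μ).groundEnergy) / ((L + 1 : ℕ) : ℝ) ^ 2) atTop (𝓝 0) ∧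
        ∃ L₀ : ℕ, ∀ L : ℕ, L₀ ≤ L → 4 * Real.exp (-C / U ^ 2) ^ 2 * ((L + 1 : ℕ) : ℝ) ^ 4 ≤
          (expect ((pairField dWaveFormFactor (L + 1) + (pairField dWaveFormFactor (L + 1))ᴴ) *
            (pairField dWaveFormFactor (L + 1) + (pairField dWaveFormFactor (L + 1))ᴴ)) (Ψ L)).re := by
  obtain ⟨δ, hδ, U₀, hU₀, C, hC, hcrux⟩ := hcrux
  refine ⟨δ, hδ, min U₀ 1, lt_min hU₀ one_pos, C + 1, by linarith, fun U hU => ?_⟩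
  obtain ⟨μ, hdens, hfloor⟩ := hcrux U ⟨hU.1, lt_of_lt_of_le hU.2 (min_le_left _ _)⟩
  refine ⟨μ, hdens, ?_⟩
  obtain ⟨n, Ψ, hΨ, hexc, L₀, hlro⟩ := lroSeedOfOrderFloor U μ (Real.exp (-C / U ^ 2)) (Real.exp_pos _) hfloor
  refine ⟨n, Ψ, hΨ, hexc, L₀, fun L hL => (le_trans ?_ (hlro L hL))⟩
  -- `e^{-(C+1)/U²} ≤ e^{-C/U²}/2` for `0 < U ≤ 1`
  have hU1 : U ≤ 1 := (lt_of_lt_of_le hU.2 (min_le_right _ _)).le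
  have hUpos : 0 < U := hU.1
  have hkey : Real.exp (-(C + 1) / U ^ 2) ≤ Real.exp (-C / U ^ 2) / 2 := by
    have hU2 : U ^ 2 ≤ 1 := by nlinarith
    have hU2pos : 0 < U ^ 2 := by positivity
    have h1 : Real.exp (-(C + 1) / U ^ 2) = Real.exp (-C / U ^ 2) * Real.exp (-(1 / U ^ 2)) := by
      rw [← Real.exp_add]; congr 1; field_simp; ring
    have h2 : Real.exp (-(1 / U ^ 2)) ≤ 1 / 2 := by
      have h3 : (1 : ℝ) ≤ 1 / U ^ 2 := by rw [le_div_iff₀ hU2pos]; linarith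
      have h4 : Real.exp (-(1 / U ^ 2)) ≤ Real.exp (-1) := Real.exp_le_exp.2 (by linarith)
      have h5 : Real.exp (-1) ≤ 1 / 2 := by
        have := Real.exp_one_gt_d9
        rw [Real.exp_neg, inv_eq_one_div, div_le_div_iff₀ (Real.exp_pos 1) two_pos]
        linarith
      exact h4.trans h5
    rw [h1]
    have := Real.exp_pos (-C / U ^ 2)
    nlinarith
  have hsq : Real.exp (-(C + 1) / U ^ 2) ^ 2 ≤ (Real.exp (-C / U ^ 2) / 2) ^ 2 :=
    pow_le_pow_left₀ (Real.exp_pos _).le hkey 2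
  have hL4 : (0 : ℝ) ≤ ((L + 1 : ℕ) : ℝ) ^ 4 := by positivity
  nlinarith [mul_le_mul_of_nonneg_right hsq hL4]

/-! ### Side stubs (provable now; calibration and bridge theorems, registered for workers)

None of these enters `WcbcsBcsConstruction_of`; each sharpens where the open content of `stub_bcsSeedCore` lives
(the bottom stair `h ≲ √U`, the `O(√U)` density jumps) or how a sourced construction would discharge it. -/

/-- Side stub (provable now, S). **Interaction comparison of the sourced pair density ("the top stairs are free-gas
stairs").** For `U ≤ U'`, every `L, μ, h` and every `r > 0`:
`D_L(U, μ, h - r) - (U' - U)/(2r) ≤ D_L(U', μ, h) ≤ D_L(U, μ, h + r) + (U' - U)/(2r)`, `D_L = dWaveSourceDensity L`.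
Proof: `h ↦ E₀(dWaveSourceTorus L U μ h)` is concave with supergradient `-2L²D_L` (`dWaveSourceDensity_mul_le_groundEnergy_drop`),
and `0 ≤ E₀(U',h) - E₀(U,h) ≤ (U' - U)L²` (the sourced Hamiltonians differ by `(U'-U)Σ_x n_{x↑}n_{x↓} ∈ [0,(U'-U)L²]`,
`hamiltonianWith_sub_hamiltonianWith`, `groundEnergy_mono_of_posSemidef_sub`, `groundEnergy_le_add_of_sub_le_smul`).
With `U = 0` and `r = h/2`: `F_{U'}(h) ≥ F_0(h/2) - U'/h`, so a floor `e^{-C/U²} ≤ F_U(h)` is automatic wherever the FREE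
response `F_0(h/2)` exceeds `U/h + e^{-C/U²}` (all `h ≳ √(U / log(1/U))`). [cite: KomaTasaki1994, §1] -/
theorem stub_interactionComparison :
    ∀ (L : ℕ) [NeZero L] (U U' μ h r : ℝ), U ≤ U' → 0 < r →
      dWaveSourceDensity L U μ (h - r) - (U' - U) / (2 * r) ≤ dWaveSourceDensity L U' μ h ∧
      dWaveSourceDensity L U' μ h ≤ dWaveSourceDensity L U μ (h + r) + (U' - U) / (2 * r) := by
  sorry

/-- Side stub (provable now, M). **BdG ground energy of the `d`-wave-sourced FREE torus** (`L ≥ 3`):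
`E₀(dWaveSourceTorus L 0 μ s) = Σ_{k ∈ (ℤ/Lℤ)²} (ξ_k - √(ξ_k² + 8 s² ĝ_d(k)²))`, `ξ_k = ε_L(k) - μ`,
`ĝ_d(k) = cos k₁ - cos k₂` — each pair `(k↑, -k↓)` contributes its two negative Bogoliubov levels. Proof: `β → ∞` in
the tree's BdG partition function `partitionFn_dWaveSourceTorus_zero_re` (per-mode
`log(e^{-βξ}(1 + cosh βE)/2) ∈ [-βξ + βE - log 4, -βξ + βE]`) with `e^{-βE₀} ≤ Re Z_β ≤ 2^{2L²}e^{-βE₀}`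
(`exp_neg_mul_groundEnergy_le_partitionFn`, `partitionFn_le_card_mul_exp`), exactly as
`groundEnergy_hubbardTorusWith_zero` (the case `s = 0`). [cite: VondelftRalph2001, §4.2] -/
theorem stub_freeSourcedGroundEnergy :
    ∀ (L : ℕ) [NeZero L], 3 ≤ L → ∀ μ s : ℝ,
      (dWaveSourceTorus L 0 μ s).groundEnergy =
        ∑ k : TorusSite 2 L, ((torusBand L k - μ) -
          Real.sqrt ((torusBand L k - μ) ^ 2 + (2 * Real.sqrt 2 * s * dWaveGap k) ^ 2)) := by
  sorry

/-- Side stub (provable now, L). **The `d`-wave-weighted zero-temperature Cooper logarithm on the torus.** For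
chemical potentials in a compact `[μ₁, μ₂] ⊂ (-4, 0)` (Fermi curve off the band edges and off the van Hove energy)
there are `c, h₀ > 0` such that for every `h ∈ (0,h₀)` and `μ ∈ [μ₁,μ₂]`, eventually in `L`,
`Σ_{k ∈ (ℤ/Lℤ)²} ĝ_d(k)² / √((ε_L(k) - μ)² + h²) ≥ c · log(1/h) · L²`.
(Count, row by row as in `TorusCooperSumRowWalk`/`TorusShellCounting`, the momenta in dyadic shells
`2^j h ≤ |ε_L(k) - μ| < 2^{j+1}h` inside an antinodal patch where `ĝ_d² ≥ 1`: each shell holds `≳ 2^j h L²` points for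
`L ≳ 1/(2^j h)`, and there are `≍ log(1/h)` shells.) With `stub_freeSourcedGroundEnergy` and the energy sandwich this is
the linear-in-`h log(1/h)` free response `F_0(h) ≥ c' h log(1/h)`. [cite: Salmhofer1999, §4.5.4] -/
theorem stub_dWaveCooperSumLowerBound :
    ∀ μ₁ μ₂ : ℝ, -4 < μ₁ → μ₁ ≤ μ₂ → μ₂ < 0 → ∃ c : ℝ, 0 < c ∧ ∃ h₀ : ℝ, 0 < h₀ ∧
      ∀ h ∈ Set.Ioo 0 h₀, ∀ μ ∈ Set.Icc μ₁ μ₂, ∃ L₀ : ℕ, ∀ (L : ℕ) [NeZero L], L₀ ≤ L →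
        c * Real.log (1 / h) * (L : ℝ) ^ 2 ≤
          ∑ k : TorusSite 2 L, dWaveGap k ^ 2 / Real.sqrt ((torusBand L k - μ) ^ 2 + h ^ 2) := by
  sorry

/-- Side stub (provable now, S). **Secant slopes of a concave function uniformly close to a `C^{1,1}` function.**
If `f` is concave, `|f - g| ≤ η` on `[x-r, x+r]` and `g` has the quadratic Taylor bound
`|g(y) - g(x) - g'(y-x)| ≤ M(y-x)²` there, then for every `t ∈ (0,r]` the right secant slope of `f` at `x` is
`≥ g' - Mr - 2η/r` and the left secant slope is `≤ g' + Mr + 2η/r` (concavity makes secant slopes monotone in `t`;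
compare at `t = r`). Hence both one-sided derivatives of `f` at `x` lie within `Mr + 2η/r` of `g'`; with
`r = √(2η/M)` the jump is `≤ 4√(2ηM)`. Ruelle, *Statistical Mechanics* (1969) §2 (convexity estimates). [folklore] -/
theorem stub_secantSlopes_of_concave_close :
    ∀ (f g : ℝ → ℝ) (g' x r η M : ℝ), 0 < r →
      ConcaveOn ℝ Set.univ f →
      (∀ y ∈ Set.Icc (x - r) (x + r), |f y - g y| ≤ η) →
      (∀ y ∈ Set.Icc (x - r) (x + r), |g y - g x - g' * (y - x)| ≤ M * (y - x) ^ 2) →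
      ∀ t ∈ Set.Ioc 0 r,
        g' - M * r - 2 * η / r ≤ (f (x + t) - f x) / t ∧ (f x - f (x - t)) / t ≤ g' + M * r + 2 * η / r := by
  sorry

/-- Side stub (provable now, M). **The interacting grand-canonical density is within `O(√U)` of the free density, at
every `μ` and along every subsequence.** Let `e(U,·)` be the limiting GC ground-state energy density of the torus
(`limUnder`; it exists by `torusEnergyDensityLimit`) and suppose the FREE limit has a quadratic Taylor bound at `μ`
with slope `-n₀` on `[μ-r, μ+r]`. Then for `0 ≤ U` every limit point of the finite-volume tracial densities
`n_{L+1}(U,μ)` lies in `[n₀ - (Mr + 2U/r), n₀ + (Mr + 2U/r)]` (`liminf`/`limsup` form). Ingredients: `e(U,·)` is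
concave (limit of concave, `concaveOn_groundEnergy_hubbardTorusWith`), `0 ≤ e(U,·) - e(0,·) ≤ U`
(`groundEnergy_torus_sub_free_mem_Icc`), the slope sandwich `gcNumber_torus_mem_Icc_slope`, and
`stub_secantSlopes_of_concave_close`. So density matching at `1 - δ` can only fail inside a density jump of width
`O(√U)`; nothing soft locates the jumps (that is `stub_bcsSeedCore`'s business). [folklore] -/
theorem stub_gcDensity_limitPoints_near_free :
    ∀ (U μ r M n₀ : ℝ), 0 ≤ U → 0 < r →
      (∀ y ∈ Set.Icc (μ - r) (μ + r),
        |limUnder atTop (fun L : ℕ => (hubbardTorusWith 2 (L + 1) 1 0 y).groundEnergy / ((L + 1 : ℕ) : ℝ) ^ 2) -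
          limUnder atTop (fun L : ℕ => (hubbardTorusWith 2 (L + 1) 1 0 μ).groundEnergy / ((L + 1 : ℕ) : ℝ) ^ 2) -
          (-n₀) * (y - μ)| ≤ M * (y - μ) ^ 2) →
      n₀ - (M * r + 2 * U / r) ≤ liminf (fun L : ℕ => ((hubbardTorusWith 2 (L + 1) 1 U μ).groundStateFunctional
          totalNumber).re / ((L + 1 : ℕ) : ℝ) ^ 2) atTop ∧
      limsup (fun L : ℕ => ((hubbardTorusWith 2 (L + 1) 1 U μ).groundStateFunctional
          totalNumber).re / ((L + 1 : ℕ) : ℝ) ^ 2) atTop ≤ n₀ + (M * r + 2 * U / r) := by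
  sorry

/-- Side stub (provable now, M; pure real analysis). **Uniform-in-`h` differentiability passes to `h ↓ 0`.** Let
`e h ·` (`h ∈ (0,h₀)`, think: the sourced energy densities) be differentiable on `[μ₁,μ₂]` with derivatives `n h ·`
that are equicontinuous in `μ` uniformly in `h`, and `|e h μ - e₀ μ| ≤ B h`. Then `e₀` is differentiable on
`(μ₁,μ₂)` with derivative `n₀ μ = lim_{h→0⁺} n h μ`, and `n₀` inherits the modulus of continuity. (Mean value
theorem: `|(e₀ μ' - e₀ μ)/(μ' - μ) - n h μ| ≤ ω(|μ' - μ|) + 2Bh/|μ' - μ|`; so `h ↦ n h μ` is Cauchy and the limit is the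
derivative.) This is how a SOURCED construction (regulator `h > 0`, control uniform as `h ↓ 0`) discharges the
density clause (D): feed the conclusion to `exists_tendsto_gcDensity_of_regularWindow`. [folklore] -/
theorem stub_eosTransfer :
    ∀ (e : ℝ → ℝ → ℝ) (e₀ : ℝ → ℝ) (n : ℝ → ℝ → ℝ) (B h₀ μ₁ μ₂ : ℝ), 0 < h₀ → μ₁ < μ₂ →
      (∀ h ∈ Set.Ioo 0 h₀, ∀ μ ∈ Set.Icc μ₁ μ₂, |e h μ - e₀ μ| ≤ B * h) →
      (∀ h ∈ Set.Ioo 0 h₀, ∀ μ ∈ Set.Icc μ₁ μ₂, HasDerivAt (e h) (n h μ) μ) →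
      (∀ ε > 0, ∃ η > 0, ∀ h ∈ Set.Ioo 0 h₀, ∀ μ ∈ Set.Icc μ₁ μ₂, ∀ μ' ∈ Set.Icc μ₁ μ₂,
          |μ - μ'| < η → |n h μ - n h μ'| < ε) →
      ∃ n₀ : ℝ → ℝ, (∀ μ ∈ Set.Ioo μ₁ μ₂, HasDerivAt e₀ (n₀ μ) μ) ∧
        (∀ μ ∈ Set.Ioo μ₁ μ₂, Tendsto (fun h => n h μ) (𝓝[>] 0) (𝓝 (n₀ μ))) ∧
        (∀ ε > 0, ∃ η > 0, ∀ μ ∈ Set.Ioo μ₁ μ₂, ∀ μ' ∈ Set.Ioo μ₁ μ₂, |μ - μ'| < η → |n₀ μ - n₀ μ'| ≤ ε) := by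
  sorry

end Summit.HubbardSuperconductivity.HubbardSuperconductivity.Cruxes.WcbcsBcsConstruction.LroSeedKinkBridge
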